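import Summits.BirchSwinnertonDyer.BirchSwinnertonDyer.Theorems.ByReductionTypeAtTwoAdditivePotGoodPrintKrizLi44a1
import HarnessLib

/-!
# K4 crux `AdditiveRankZeroAtTwo` (19098), children C3″ (22617) / C1″ (22615): the Kriz–Li road at `44a1` is NOT VACUOUS — the index set
# `𝒩(44a1, ℚ(√−7))` from explicit congruences and the member `d = −23` (`a₂₃(44a1) = −3` odd, `(−7/23) = 1`, `−23 ≡ 1 (mod 4)`,
# `χ_{−23}(−44) = −(44/23) = 1`): `BSD(·, 2)` with both K4 halves at every global minimal `44a1^{(−23)}` (rank `0`) and `BSD(·, 2)` at every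
# global minimal `44a1^{(161)}` (rank `1`)

Cell `bsd-2adic`, seat `bsd-2adic-k4-w2` GEN 7 (prover, explicit unit, no kit); `--supports stmt-BirchSwinnertonDyer-22617 --as helper`;
companion of `…PrintKrizLi44a1.lean`. HONEST FRAMING (D-0036/D-0054): kernel certificates of Kriz–Li's membership conditions (Def 4.1: `ℓ ∤ 2N`,
`ℓ` split in `K`, `a_ℓ(E)` odd — by a certified point count `#Ẽ(𝔽₂₃) = 27`; `d ≡ 1 (mod 4)` square-free; `χ_d(−N) = sgn(d)·(N/|d|) = 1` with
`N = 44` exact) and the road's conclusions at the two members, from the by-name theorems of the companion file (inputs: Thm 5.1 (2), Thm 4.3,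
Table-2 row `44a1`, Creutz–Miller, ARS, GZK; displayed `r_an(44a1) = 0`). The first members of `𝒩(44a1, ℚ(√−7))` with `χ_d(−44) = 1` are
`d = −23, 37, −67, −71, 113, 137, −179, −191, …` (seat script `tools/krizli_data.py`). Closes nothing at the `∀`-level; nothing booked;
BSD is not proved by any of this.

References: [KrizLi2019] Def 4.1, Thm 5.1 (2), §6 Table 2 (row 44a1); [SilvermanAEC2009] V.2 (point counts); [Marcus1977] Ch. 3 Thm. 25.
-/

set_option autoImplicit false
-- the Theorems namespace of this sub repeats the summit name by design (D-0017 nested layout)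
set_option linter.dupNamespace false

noncomputable section

open scoped Classical

open WeierstrassCurve NumberField Literature.NumberTheory.EllipticCurves
  Literature.NumberTheory.EllipticCurves.ModularForms
  Literature.NumberTheory.EllipticCurves.Rank1Residual
  Literature.NumberTheory.EllipticCurves.Rank1Residual.Typed
  Literature.NumberTheory.EllipticCurves.AgasheRibetStein2006
  Summit.BirchSwinnertonDyer
  Summit.BirchSwinnertonDyer.Rank1Residual
  Summit.BirchSwinnertonDyer.Rank1Residual.X11b
  Summit.BirchSwinnertonDyer.Rank1Residual.X5.O1
  Summit.BirchSwinnertonDyer.Rank1Residual.P2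
  Summit.BirchSwinnertonDyer.BirchSwinnertonDyer.Rank1Residual.IntModel
  Summit.BirchSwinnertonDyer.BirchSwinnertonDyer.Theorems

namespace Summit.BirchSwinnertonDyer.BirchSwinnertonDyer.Theorems.AddPotGoodPrint

/-! ## §1 `ℓ ∈ 𝒮(44a1, K)` and `d ∈ 𝒩(44a1, K)` from explicit congruences (`d_K = −7`, `N = 44`) -/
section IndexSet44A1

/-- **`ℓ ∈ 𝒮(44a1, K)`** (Kriz–Li Def 4.1) from: `ℓ` prime, `ℓ ∉ {2, 11}` (`⟺ ℓ ∤ 2N = 88`), `(−7/ℓ) = 1` (`ℓ` splits in `K`), `a_ℓ(44a1)` odd.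
[cite: KrizLi2019, Def. 4.1 (FMS) = arXiv Def. 3.1] [cite: Marcus1977, Ch. 3 Thm. 25] -/
theorem inS_44A1 {K : Type} [Field K] [NumberField K] (h2 : Module.finrank ℚ K = 2) (hdK : NumberField.discr K = -7)
    {ℓ : ℕ} (hℓ : ℓ.Prime) (hℓ2 : ℓ ≠ 2) (hℓ11 : ℓ ≠ 11) (hj : jacobiSym (-7) ℓ = 1)
    (hodd : haveI := isGloballyMinimal_44A1; Odd ((⟨0, 1, 0, 3, -1⟩ : WeierstrassCurve ℚ).frobeniusTrace ℓ)) :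
    haveI := isGloballyMinimal_44A1
    KrizLi2019.InS (⟨0, 1, 0, 3, -1⟩ : WeierstrassCurve ℚ) K ℓ := by
  haveI := isElliptic_44A1; haveI := isGloballyMinimal_44A1
  refine ⟨hℓ, ?_, ?_, hodd⟩
  · rw [conductorNorm_44A1]
    intro h
    have h' : ℓ ∣ 2 ^ 3 * 11 := by simpa using h
    rcases (Nat.Prime.dvd_mul hℓ).mp h' with h | h
    · exact hℓ2 ((Nat.prime_dvd_prime_iff_eq hℓ Nat.prime_two).mp (hℓ.dvd_of_dvd_pow h))
    · exact hℓ11 ((Nat.prime_dvd_prime_iff_eq hℓ (by norm_num)).mp h)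
  · rw [Literature.NumberTheory.QuadraticFields.Quadratic.ncard_primesOver_eq_two_iff_jacobiSym h2 hℓ hℓ2, hdK]
    exact hj

/-- **`d ∈ 𝒩(44a1, K)`** (Kriz–Li Def 4.1: `d ≡ 1 (mod 4)`, `|d|` a square-free product of primes in `𝒮`) from the explicit conditions on
the prime factors. [cite: KrizLi2019, Def. 4.1 (FMS) = arXiv Def. 3.1] -/
theorem inN_44A1 {K : Type} [Field K] [NumberField K] (h2 : Module.finrank ℚ K = 2) (hdK : NumberField.discr K = -7)
    {d : ℤ} (hd4 : d % 4 = 1) (hsq : Squarefree d.natAbs)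
    (hprimes : haveI := isGloballyMinimal_44A1; ∀ ℓ : ℕ, ℓ.Prime → ℓ ∣ d.natAbs →
      ℓ ≠ 2 ∧ ℓ ≠ 11 ∧ jacobiSym (-7) ℓ = 1 ∧ Odd ((⟨0, 1, 0, 3, -1⟩ : WeierstrassCurve ℚ).frobeniusTrace ℓ)) :
    haveI := isGloballyMinimal_44A1
    KrizLi2019.InN (⟨0, 1, 0, 3, -1⟩ : WeierstrassCurve ℚ) K d :=
  ⟨hd4, hsq, fun ℓ hℓ hℓd =>
    inS_44A1 h2 hdK hℓ (hprimes ℓ hℓ hℓd).1 (hprimes ℓ hℓ hℓd).2.1 (hprimes ℓ hℓ hℓd).2.2.1 (hprimes ℓ hℓ hℓd).2.2.2⟩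

/-- **The sign condition `χ_d(−44) = 1`, read with `N = 44` exact**: it is `sgn(d)·(44/|d|) = 1`. [cite: KrizLi2019, Thm. 5.1 (2) condition "χ_d(−N) = 1"] -/
theorem sign_44A1 {d : ℤ} (h : Int.sign d * jacobiSym 44 d.natAbs = 1) :
    haveI := isElliptic_44A1
    Int.sign d * jacobiSym ((⟨0, 1, 0, 3, -1⟩ : WeierstrassCurve ℚ).conductorNorm ℤ) d.natAbs = 1 := by
  rw [conductorNorm_44A1]; exact_mod_cast h

end IndexSet44A1

/-! ## §2 The witness `ℓ = 23`: `a₂₃(44a1) = −3` odd, `23` splits in `ℚ(√−7)`; `d = −23 ∈ 𝒩`, `χ_{−23}(−44) = 1` -/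
section Witness44A1neg23

/-- **`#Ẽ(𝔽₂₃) = 27` for `44a1`** (certified count; `23 ∤ Δ = −2816`), so `a₂₃ = 24 − 27 = −3`. [cite: SilvermanAEC2009, V.2] -/
theorem reductionPointCount_23_44A1 [(⟨0, 1, 0, 3, -1⟩ : WeierstrassCurve ℚ).IsGloballyMinimal] :
    (⟨0, 1, 0, 3, -1⟩ : WeierstrassCurve ℚ).reductionPointCount 23 = 27 := by
  haveI : Fact (Nat.Prime 23) := ⟨by norm_num⟩
  haveI := isElliptic_44A1
  exact Supersingular.reductionPointCount_eq_of_intModel_countPoints intModel_44A1 23 (by norm_num) (by decide +kernel)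
    (by decide +kernel)

/-- **`a₂₃(44a1)` is odd** (`= −3`): `Frob₂₃` has order `3` on `E[2]` — Kriz–Li's condition for `23 ∈ 𝒮`. [cite: KrizLi2019, Def. 4.1 ("Frob_ℓ of order 3")] -/
theorem odd_frobeniusTrace_23_44A1 [(⟨0, 1, 0, 3, -1⟩ : WeierstrassCurve ℚ).IsGloballyMinimal] :
    Odd ((⟨0, 1, 0, 3, -1⟩ : WeierstrassCurve ℚ).frobeniusTrace 23) := by
  rw [Uniform.U2.odd_frobeniusTrace_iff_odd_reductionPointCount _ (by norm_num : Nat.Prime 23) (by norm_num),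
    reductionPointCount_23_44A1]
  decide

/-- **`−23 ∈ 𝒩(44a1, K)`** for every quadratic `K` with `d_K = −7`: `−23 ≡ 1 (mod 4)`, `23` prime `∉ {2, 11}`, `(−7/23) = (16/23) = 1`,
`a₂₃` odd. [cite: KrizLi2019, Def. 4.1] -/
theorem inN_neg23_44A1 {K : Type} [Field K] [NumberField K] (h2 : Module.finrank ℚ K = 2) (hdK : NumberField.discr K = -7) :
    haveI := isGloballyMinimal_44A1
    KrizLi2019.InN (⟨0, 1, 0, 3, -1⟩ : WeierstrassCurve ℚ) K (-23) := by
  haveI := isGloballyMinimal_44A1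
  have h23 : Nat.Prime 23 := by norm_num
  have hna : (-23 : ℤ).natAbs = 23 := rfl
  refine inN_44A1 h2 hdK (by decide) (by rw [hna]; exact h23.squarefree) fun ℓ hℓ hℓd => ?_
  rw [hna] at hℓd
  obtain rfl := (Nat.prime_dvd_prime_iff_eq hℓ h23).mp hℓd
  exact ⟨by norm_num, by norm_num, by norm_num, odd_frobeniusTrace_23_44A1⟩

/-- **`χ_{−23}(−44) = 1`**: `sgn(−23)·(44/23) = (−1)·(−1) = 1`. [cite: KrizLi2019, Thm. 5.1 (2) condition "χ_d(−N) = 1"] -/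
theorem sign_neg23_44A1 :
    haveI := isElliptic_44A1
    Int.sign (-23) * jacobiSym ((⟨0, 1, 0, 3, -1⟩ : WeierstrassCurve ℚ).conductorNorm ℤ) (-23 : ℤ).natAbs = 1 :=
  sign_44A1 (by rw [show (-23 : ℤ).natAbs = 23 from rfl]; norm_num)

/-- **C3″'s conclusion AND the Kato-side half at every global minimal model of `44a1^{(−23)}`** (the member `d = −23` of the Kriz–Li family;
`K` any quadratic field with `d_K = −7`, e.g. the tree's `sqrtField (−7)`): `r_an = 0 ∧ Addv ∧ 0 ≤ ord₂ j ∧ ¬CM ∧ Irr ∧ BSD(·,2) ∧ MissingLower ∧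
MissingUpper`. By name: Kriz–Li Thm 5.1 (2) + 4.3 + Table-2 row, Creutz–Miller, ARS, GZK; displayed: `r_an(44a1) = 0`. The `44a1` road is not
vacuous. BSD is not proved by any of this. [cite: KrizLi2019, Thm. 5.1 (2), Thm. 4.3, §6 Table 2 (row 44a1)] [cite: CreutzMiller2012, Thm. 1.1]
[cite: AgasheRibetStein2006, Thm. 2.6] [cite: Miller2011LMS, Def. 1.1] -/
theorem printFamily44A1_krizLi_witness_neg23 (hKL : KrizLi2019.thm112_bsdTwo_twist) (h33 : KrizLi2019.thm33_rank_twist)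
    (htab : KrizLi2019.table2_row44a1) (hS31 : bsdTriple_of_analyticRank_le_one_of_conductor_lt)
    (h26 : cremona_abs_maninConstant_eq_one_of_level_le) (hGZK : rank_eq_analyticRank_of_analyticRank_le_one)
    (hr : haveI := isElliptic_44A1; (⟨0, 1, 0, 3, -1⟩ : WeierstrassCurve ℚ).analyticRank = 0)
    (K : Type) [Field K] [NumberField K] (hK : IsImaginaryQuadratic K) (hdK : NumberField.discr K = -7)
    (W₁ : WeierstrassCurve ℚ) [W₁.IsElliptic] [W₁.IsGloballyMinimal]
    (hW₁ : ∃ C : VariableChange ℚ, C • (⟨0, 1, 0, 3, -1⟩ : WeierstrassCurve ℚ).quadraticTwist ((-23 : ℤ) : ℚ) = W₁) :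
    haveI : Fact (Nat.Prime 2) := ⟨Nat.prime_two⟩
    W₁.analyticRank = 0 ∧ Addv W₁ 2 ∧ 0 ≤ padicValRat 2 W₁.j ∧ ¬ W₁.HasCM ∧ Irr W₁ 2 ∧
      BSDp W₁ 2 ∧ MissingLowerBoundAt W₁ 2 ∧ MissingUpperBoundAt W₁ 2 :=
  printFamily44A1_krizLi_rankZero hKL h33 htab hS31 h26 hGZK hr K hK hdK (inN_neg23_44A1 hK.1 hdK) sign_neg23_44A1 W₁ hW₁

/-- **The rank-one companion `44a1^{(161)}`** (`161 = (−7)·(−23)`): at every global minimal model, `r_an = 1 ∧ Addv ∧ 0 ≤ ord₂ j ∧ ¬CM ∧ Irr ∧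
BSD(·, 2)`. BSD is not proved by any of this. [cite: KrizLi2019, Thm. 5.1 (2), Thm. 4.3, §6 Table 2 (row 44a1)] [cite: CreutzMiller2012, Thm. 1.1]
[cite: Miller2011LMS, Def. 1.1] -/
theorem printFamily44A1_krizLi_witness161 (hKL : KrizLi2019.thm112_bsdTwo_twist) (h33 : KrizLi2019.thm33_rank_twist)
    (htab : KrizLi2019.table2_row44a1) (hS31 : bsdTriple_of_analyticRank_le_one_of_conductor_lt)
    (h26 : cremona_abs_maninConstant_eq_one_of_level_le)
    (hr : haveI := isElliptic_44A1; (⟨0, 1, 0, 3, -1⟩ : WeierstrassCurve ℚ).analyticRank = 0)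
    (K : Type) [Field K] [NumberField K] (hK : IsImaginaryQuadratic K) (hdK : NumberField.discr K = -7)
    (W₂ : WeierstrassCurve ℚ) [W₂.IsElliptic] [W₂.IsGloballyMinimal]
    (hW₂ : ∃ C : VariableChange ℚ, C • (⟨0, 1, 0, 3, -1⟩ : WeierstrassCurve ℚ).quadraticTwist ((161 : ℤ) : ℚ) = W₂) :
    haveI : Fact (Nat.Prime 2) := ⟨Nat.prime_two⟩
    W₂.analyticRank = 1 ∧ Addv W₂ 2 ∧ 0 ≤ padicValRat 2 W₂.j ∧ ¬ W₂.HasCM ∧ Irr W₂ 2 ∧ BSDp W₂ 2 :=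
  printFamily44A1_krizLi_rankOne hKL h33 htab hS31 h26 hr K hK hdK (inN_neg23_44A1 hK.1 hdK) sign_neg23_44A1 W₂
    (by rw [show ((-7 * -23 : ℤ) : ℚ) = ((161 : ℤ) : ℚ) by norm_num]; exact hW₂)

end Witness44A1neg23

end Summit.BirchSwinnertonDyer.BirchSwinnertonDyer.Theorems.AddPotGoodPrint

end
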